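import Mathlib
import Summits.CriticalPhenomena.SAWScalingLimit.Theorems.SAWDefectDecoherenceObservableToSLERGateTransferHexagonBounds
import Summits.CriticalPhenomena.SAWScalingLimit.Theorems.SAWDefectDecoherenceObservableToSLERGateTransferSides

/-!
# Gate transfer, sides 1: walks of Ω_δ; nondegeneracy of the gates; the prefix lies in the root side

Support file for the stub `stub_gateTransfer` (the gate transfer
`GateDecomposition → RenewalAccumulation → CarvedToSLE → HexTight → FullIdentification`) of the
line `bridge-gate-renewal` for the crux
`Summit.CriticalPhenomena.SAWScalingLimit.Theses.SAWDefectDecoherence.ObservableToSLER`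
(item `stmt-CriticalPhenomena-14005`).

* walks of `Ω_δ = hexDomainGraph Ω δ`: adjacency, every vertex of a walk with an edge has its
  rescaled centre in `Ω`, consecutive vertices are adjacent, first exits give an edge `{p, q}`;
* `exists_two_frontier_points` — if `∂D` passes through the interior of a closed `K` and leaves
  `K`, two distinct points of `∂K` lie outside `D` (so the gate cut is a genuine cross-cut);
* `take_subset_sideVerts` (registered sub-goal `stub_prefixInRootSide`; the topological heart,
  part (α)) — the prefix of a first exit lies in the root side `gateSide` of the crosscut
  through the gate.
-/

noncomputable section

open scoped BigOperators Topology NNReal ENNReal Classical BoundedContinuousFunction unitInterval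
open Filter Set MeasureTheory Metric

namespace Summit.CriticalPhenomena.SAWScalingLimit.Theorems.ObservableToSLER.BridgeGate

open Literature.Probability.LatticeModels (HexVertex hexGraph hexCenter triZeta Site polyline)
open Literature.Probability.RandomPlanarGeometry
open Literature.Probability.RandomPlanarGeometry.SAW
open Summit.CriticalPhenomena.SAWScalingLimit.Theorems.ObservableToSLE.Negative
  (mem_embMeshDomain_of_mem_support_tail)

section Walks

variable {Ω : Set ℂ} {δ : ℝ}

/-- Adjacency in `Ω_δ`: a honeycomb edge whose rescaled segment lies in `Ω̄`, between vertices of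
the discrete domain. -/
theorem adj_hexDomainGraph_iff {u v : HexVertex} :
    (hexDomainGraph Ω δ).Adj u v ↔ (hexGraph.Adj u v ∧
      segment ℝ ((δ : ℂ) * hexCenter u) ((δ : ℂ) * hexCenter v) ⊆ closure Ω) ∧
      u ∈ embMeshDomain hexGraph hexCenter Ω δ ∧ v ∈ embMeshDomain hexGraph hexCenter Ω δ := by
  rw [hexDomainGraph, embDomainGraph_adj_iff, embMeshGraph_adj_iff]

/-- The endpoints of an edge of `Ω_δ` have rescaled centres in `Ω`. -/
theorem mem_of_adj_hexDomainGraph {u v : HexVertex} (h : (hexDomainGraph Ω δ).Adj u v) :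
    (δ : ℂ) * hexCenter u ∈ Ω ∧ (δ : ℂ) * hexCenter v ∈ Ω := by
  rw [adj_hexDomainGraph_iff] at h
  exact ⟨embMeshDomain_subset _ _ _ _ h.2.1, embMeshDomain_subset _ _ _ _ h.2.2⟩

/-- Every vertex of a walk of `Ω_δ` with at least one edge has its rescaled centre in `Ω`. -/
theorem mem_of_mem_support {u v : HexVertex} (w : (hexDomainGraph Ω δ).Walk u v) (hw : ¬ w.Nil)
    {x : HexVertex} (hx : x ∈ w.support) : (δ : ℂ) * hexCenter x ∈ Ω := by
  cases w with
  | nil => exact absurd SimpleGraph.Walk.Nil.nil hw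
  | cons h p =>
    rw [SimpleGraph.Walk.support_cons, List.mem_cons] at hx
    rcases hx with rfl | hx
    · exact (mem_of_adj_hexDomainGraph h).1
    · exact embMeshDomain_subset _ _ _ _
        (mem_embMeshDomain_of_mem_support_tail (SimpleGraph.Walk.cons h p) (by simpa using hx))

/-- Consecutive vertices of a walk are adjacent. -/
theorem adj_of_getElem {V : Type*} {G : SimpleGraph V} {u v : V} (w : G.Walk u v) {i : ℕ}
    (hi : i + 1 < w.support.length) :
    G.Adj (w.support[i]'(by omega)) (w.support[i + 1]'hi) :=
  List.isChain_iff_getElem.1 w.isChain_adj_support i hi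

/-- A walk with a first exit has an edge. -/
theorem not_nil_of_isFirstExit {u v c : HexVertex} {n m : ℕ} {p q : HexVertex}
    (w : (hexDomainGraph Ω δ).Walk u v) (h : IsFirstExit c n w.support m p q) : ¬ w.Nil := by
  rw [← SimpleGraph.Walk.length_eq_zero_iff]
  intro h0
  have h1 := h.lt_length
  have h2 := h.pos
  rw [SimpleGraph.Walk.length_support, h0] at h1
  omega

/-- In a first exit of a walk, `p` and `q` are adjacent in `Ω_δ`. -/
theorem IsFirstExit.adj {u v c : HexVertex} {n m : ℕ} {p q : HexVertex}
    (w : (hexDomainGraph Ω δ).Walk u v) (h : IsFirstExit c n w.support m p q) :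
    (hexDomainGraph Ω δ).Adj p q := by
  have hm := h.pos
  have hml := h.lt_length
  have hp := h.getElem?_pred_eq
  have hq := h.getElem?_eq
  rw [List.getElem?_eq_some_iff] at hp hq
  obtain ⟨_, rfl⟩ := hp
  obtain ⟨_, rfl⟩ := hq
  have := adj_of_getElem w (i := m - 1) (by omega)
  simpa [Nat.sub_add_cancel hm] using this

end Walks

section Nondegenerate

open Literature.Probability.RandomPlanarGeometry (JordanDomain)

/-- **Two points of `∂K` outside `D`**: if the boundary curve of the Jordan domain `D` passes
through the interior of the closed set `K` and also leaves `K`, it crosses `∂K` at two distinct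
points (which are not in the open set `D`). -/
theorem exists_two_frontier_points (D : JordanDomain) {K : Set ℂ} (hKcl : IsClosed K) {w₁ w₂ : ℂ}
    (hw₁ : w₁ ∈ frontier D.carrier) (hw₁K : w₁ ∈ interior K) (hw₂ : w₂ ∈ frontier D.carrier)
    (hw₂K : w₂ ∉ K) :
    ∃ z₁ z₂ : ℂ, z₁ ∈ frontier K ∧ z₁ ∉ D.carrier ∧ z₂ ∈ frontier K ∧ z₂ ∉ D.carrier ∧ z₁ ≠ z₂ := by
  rw [← D.range_boundary] at hw₁ hw₂
  obtain ⟨a₁, rfl⟩ := hw₁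
  obtain ⟨a₂', ha₂'⟩ := hw₂
  obtain ⟨a₂, ha₂, ha₂eq⟩ := D.periodic_boundary.exists_mem_Ico one_pos a₂' a₁
  rw [ha₂eq] at ha₂'
  subst ha₂'
  have ha₁₂ : a₁ < a₂ := ha₂.1.lt_of_ne (by rintro rfl; exact hw₂K (interior_subset hw₁K))
  -- a connected piece of the boundary curve from inside `K°` to outside `K` meets `∂K`
  have cross : ∀ {s t : ℝ}, s ≤ t → (D.boundary s ∈ interior K ∧ D.boundary t ∉ K ∨
      D.boundary t ∈ interior K ∧ D.boundary s ∉ K) →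
      ∃ u ∈ Icc s t, D.boundary u ∈ frontier K := by
    intro s t hst hends
    by_contra hcon
    push Not at hcon
    set P := D.boundary '' Icc s t with hP
    have hPc : IsPreconnected P := isPreconnected_Icc.image _ D.continuous_boundary.continuousOn
    have hPsub : P ⊆ interior K ∪ Kᶜ := by
      rintro _ ⟨u, hu, rfl⟩
      have h := hcon u hu
      rw [frontier, hKcl.closure_eq] at h
      by_cases hK : D.boundary u ∈ K
      · left; by_contra hi; exact h ⟨hK, hi⟩
      · exact Or.inr hK
    have hdisj : Disjoint (interior K) Kᶜ := disjoint_compl_right.mono_left interior_subset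
    rcases hends with ⟨h1, h2⟩ | ⟨h1, h2⟩
    · have := hPc.subset_left_of_subset_union isOpen_interior hKcl.isOpen_compl hdisj hPsub
        ⟨_, ⟨s, ⟨le_rfl, hst⟩, rfl⟩, h1⟩
      exact h2 (interior_subset (this ⟨t, ⟨hst, le_rfl⟩, rfl⟩))
    · have := hPc.subset_left_of_subset_union isOpen_interior hKcl.isOpen_compl hdisj hPsub
        ⟨_, ⟨t, ⟨hst, le_rfl⟩, rfl⟩, h1⟩
      exact h2 (interior_subset (this ⟨s, ⟨le_rfl, hst⟩, rfl⟩))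
  obtain ⟨u₁, hu₁, hz₁⟩ := cross ha₁₂.le (Or.inl ⟨hw₁K, hw₂K⟩)
  obtain ⟨u₂, hu₂, hz₂⟩ := cross ha₂.2.le (Or.inr ⟨by rw [D.periodic_boundary]; exact hw₁K, hw₂K⟩)
  have hnotD : ∀ u, D.boundary u ∉ D.carrier := fun u h => by
    have := D.boundary_mem_frontier u
    rw [frontier, D.isOpen.interior_eq] at this
    exact this.2 h
  refine ⟨D.boundary u₁, D.boundary u₂, hz₁, hnotD u₁, hz₂, hnotD u₂, fun heq => ?_⟩
  -- distinctness by injectivity on the period `[a₁, a₁ + 1)`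
  have hfrK : ∀ {z}, z ∈ frontier K → z ∈ K ∧ z ∉ interior K := fun hz => by
    rw [frontier, hKcl.closure_eq] at hz; exact hz
  rcases hu₂.2.lt_or_eq with hlt | heq₂
  · have := D.injOn_boundary_Ico a₁ ⟨hu₁.1, by linarith [hu₁.2, ha₂.2]⟩ ⟨by linarith [hu₂.1], hlt⟩ heq
    have hu : u₁ = a₂ := le_antisymm hu₁.2 (this ▸ hu₂.1)
    rw [hu] at hz₁
    exact hw₂K (hfrK hz₁).1
  · rw [heq₂, D.periodic_boundary] at hz₂
    exact (hfrK hz₂).2 hw₁K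

end Nondegenerate

section RootSide

variable (D : DobrushinDomain) {δ : ℝ}

/-- **The prefix of a first exit lies in the root side** (topological heart, part (α)): for a
walk of `Ω_δ` (`Ω` the Dobrushin domain) making its first exit from the lattice hexagon of level
`n` around `c` through `{p, q}`, every vertex visited before the exit has its rescaled centre in
the root side `gateSide` of the crosscut through the gate (consecutive centres are joined by
segments of `Ω̄` inside the open hexagon, which cannot cross from one side of the cut to the
other: `mem_connectedComponentIn_of_segment`). -/
theorem take_subset_sideVerts (hδ : 0 < δ) {c e : HexVertex} {n : ℕ}
    (hz : ∃ z₁ z₂ : ℂ, z₁ ∈ frontier (contHex δ c n) ∧ z₁ ∉ D.carrier ∧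
      z₂ ∈ frontier (contHex δ c n) ∧ z₂ ∉ D.carrier ∧ z₁ ≠ z₂)
    (w : (hexDomainGraph D.carrier δ).Walk c e) {m : ℕ} {p q : HexVertex}
    (hfe : IsFirstExit c n w.support m p q) :
    ∀ v ∈ w.support.take m, v ∈ sideVerts D.carrier δ c n p q := by
  have hnil := not_nil_of_isFirstExit w hfe
  have hΩ : ∀ x ∈ w.support, (δ : ℂ) * hexCenter x ∈ D.carrier :=
    fun x hx => mem_of_mem_support w hnil hx
  set l₁ := w.support.take m with hl₁
  have hl₁K : ∀ v ∈ l₁, v ∈ hexBall c n := hfe.2.2.1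
  have hl₁ne : l₁ ≠ [] := by
    intro h; have := hfe.1; rw [← hl₁, h] at this; simp at this
  have hlast : l₁.getLast hl₁ne = p := by
    have := hfe.1
    rw [← hl₁, List.getLast?_eq_some_getLast hl₁ne, Option.some_inj] at this
    exact this
  have hpΩ : (δ : ℂ) * hexCenter p ∈ D.carrier :=
    hΩ p (List.mem_of_mem_take (hlast ▸ List.getLast_mem hl₁ne))
  set cut := gateCut D.carrier δ c n p q with hcut
  have hcutK : cut ⊆ frontier (contHex δ c n) :=
    (connectedComponentIn_subset _ _).trans inter_subset_left
  -- the goal, as a statement about the component of `δ c_p`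
  suffices H : ∀ v ∈ l₁, (δ : ℂ) * hexCenter v ∈ connectedComponentIn (D.carrier \ cut)
      ((δ : ℂ) * hexCenter p) from H
  by_cases hg : gatePoint δ p q ∈ frontier (contHex δ c n) ∩ D.carrier
  · -- the genuine crosscut: propagate along the prefix, backwards from `p`
    obtain ⟨z₁, z₂, hz₁, hz₁D, hz₂, hz₂D, hne⟩ := hz
    have hKc := convex_contHex δ c n
    have hKi := interior_contHex_nonempty hδ c n
    have hKb : Bornology.IsBounded (contHex δ c n) :=
      isBounded_closedBall.subset (contHex_subset_closedBall hδ c n)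
    have hch : List.IsChain (fun x y => x ∈ l₁ ∧ y ∈ l₁ ∧ (hexDomainGraph D.carrier δ).Adj x y) l₁ :=
      List.IsChain.iff_mem.1 (w.isChain_adj_support.take m)
    refine hch.backwards_induction (fun v => (δ : ℂ) * hexCenter v ∈
      connectedComponentIn (D.carrier \ cut) ((δ : ℂ) * hexCenter p)) l₁ ?_ ?_
    · rintro x y ⟨hx, hy, hadj⟩ hPy
      have hseg := ((adj_hexDomainGraph_iff).1 hadj).1.2
      have hyx : (δ : ℂ) * hexCenter x ∈ connectedComponentIn (D.carrier \ cut) ((δ : ℂ) * hexCenter y) :=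
        mem_connectedComponentIn_of_segment D.toJordanDomain hKc hKi hKb hg.1 hg.2 hz₁ hz₁D hz₂ hz₂D
          hne hcut (hΩ y (List.mem_of_mem_take hy)) (hΩ x (List.mem_of_mem_take hx))
          (openHex_subset_interior (hexCenter_mem_openHex hδ (hl₁K y hy)))
          (openHex_subset_interior (hexCenter_mem_openHex hδ (hl₁K x hx)))
          (by rwa [segment_symm])
      rwa [← connectedComponentIn_eq hPy] at hyx
    · intro hne'
      rw [hlast]
      exact mem_connectedComponentIn ⟨hpΩ, fun h => hexCenter_not_mem_frontier hδ p (hcutK h)⟩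
  · -- degenerate gate point: the cut is empty and the root side is all of `Ω`
    have hempty : cut = ∅ := connectedComponentIn_eq_empty hg
    intro v hv
    rw [hempty, sdiff_empty]
    exact D.isConnected.isPreconnected.subset_connectedComponentIn hpΩ subset_rfl
      (hΩ v (List.mem_of_mem_take hv))

end RootSide

end Summit.CriticalPhenomena.SAWScalingLimit.Theorems.ObservableToSLER.BridgeGate

namespace Summit.CriticalPhenomena.SAWScalingLimit.Theorems.ObservableToSLER.BridgeGate

open Literature.Probability.LatticeModels (HexVertex hexGraph hexCenter triZeta Site)
open Literature.Probability.RandomPlanarGeometry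
open Literature.Probability.RandomPlanarGeometry.SAW

/-- **Registered sub-goal `stub_prefixInRootSide`** (self-contained form of `take_subset_sideVerts`). -/
theorem stub_prefixInRootSide : ∀ (D : DobrushinDomain) (δ : ℝ) (c e : HexVertex) (n m : ℕ) (p q : HexVertex) (w : (hexDomainGraph D.carrier δ).Walk c e), 0 < δ → (∃ z₁ z₂ : ℂ, z₁ ∈ frontier (contHex δ c n) ∧ z₁ ∉ D.carrier ∧ z₂ ∈ frontier (contHex δ c n) ∧ z₂ ∉ D.carrier ∧ z₁ ≠ z₂) → IsFirstExit c n w.support m p q → ∀ v ∈ w.support.take m, v ∈ sideVerts D.carrier δ c n p q :=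
  fun D _ _ _ _ _ _ _ w hδ hz hfe => take_subset_sideVerts D hδ hz w hfe

end Summit.CriticalPhenomena.SAWScalingLimit.Theorems.ObservableToSLER.BridgeGate

end
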